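import Summits.KontsevichZagierPeriods.KontsevichZagierPeriods.Theses.Grothendieck
import Summits.KontsevichZagierPeriods.KontsevichZagierPeriods.Theorems.MultiplicationAccessible.Negative.Core
import Literature.NumberTheory.Transcendental.KZKernelConjectureForms

/-!
# KontsevichZagierPeriods / SectorComplement — no-go for integer- and finite-valued invariants

Problem `KontsevichZagierPeriods`, route Grothendieck, crux `SectorComplement` (stmt-11102). The only
possible refutation of the crux is a disproof of the summit (`Negative/Core.lean`, `not_crux_iff`), i.e.
an additive invariant `J : KZ.FormalRep →+ A` vanishing on `KZ.relations` and non-zero on some element of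
`ker KZ.eval`. This file closes the cheapest class of candidates: since `FormalRep ⧸ relations` is
divisible (`[c] = m • [scale (1/m) c]`, tree theorem
`MultiplicationAccessible.Negative.sub_nsmul_scale_inv_mem_relations`) the image of every move-invariant
is a divisible subgroup (`invariant_divisible`), so every `ℤ`-valued invariant (`invariant_int_apply_eq_zero`)
and every finite-valued invariant (`invariant_finite_apply_eq_zero`: parities, residues, counting
invariants) vanishes identically and can refute neither the summit nor the crux
(`not_separating_of_int`, `not_separating_of_finite`). Torsion-freeness (tree theorem
`mem_relations_of_nsmul_mem_relations`) disposes of the dual worry "only a multiple is derivable"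
(`nsmul_mem_relations_iff`). [Kontsevich–Zagier 2001, §1.2]
-/

noncomputable section

namespace Summit.KontsevichZagierPeriods.SectorComplement.Negative

open Literature.NumberTheory.Transcendental
open Literature.NumberTheory.Transcendental.KZ
open Summit.KontsevichZagierPeriods.MultiplicationAccessible.Negative
  (sub_nsmul_scale_inv_mem_relations mem_relations_of_nsmul_mem_relations isAlgebraic_inv_nat)
open Summit.KontsevichZagierPeriods.KontsevichZagierPeriods.Theses.Grothendieck
  (SectorComplement LemniscaticSectorKernel GpcZeta4Eq4zeta31)

/-- Move-invariance on the four generating move sets is the same as `relations ≤ ker J`. [folklore] -/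
theorem relations_le_ker_iff {A : Type*} [AddCommGroup A] (J : FormalRep →+ A) :
    relations ≤ J.ker ↔
      ∀ x ∈ domainAddRel ∪ integrandAddRel ∪ changeOfVariablesRel ∪ newtonLeibnizRel, J x = 0 :=
  ⟨fun h _ hx => h (AddSubgroup.subset_closure hx), fun h => (AddSubgroup.closure_le _).mpr fun x hx => h x hx⟩

/-- **The image of a move-invariant is divisible.** [folklore] -/
theorem invariant_divisible {A : Type*} [AddCommGroup A] (J : FormalRep →+ A) (hJ : relations ≤ J.ker)
    (c : FormalRep) {m : ℕ} (hm : m ≠ 0) : ∃ c' : FormalRep, J c = m • J c' := by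
  refine ⟨scale ((m : ℝ)⁻¹) (isAlgebraic_inv_nat m) c, ?_⟩
  have h := hJ (sub_nsmul_scale_inv_mem_relations hm c)
  rwa [AddMonoidHom.mem_ker, map_sub, map_nsmul, sub_eq_zero] at h

/-- **No `ℤ`-valued move-invariant.** [folklore] -/
theorem invariant_int_apply_eq_zero (J : FormalRep →+ ℤ) (hJ : relations ≤ J.ker) (c : FormalRep) :
    J c = 0 := by
  obtain ⟨c', h⟩ := invariant_divisible J hJ c (Nat.succ_ne_zero (J c).natAbs)
  rw [nsmul_eq_mul] at h
  refine Int.eq_zero_of_dvd_of_natAbs_lt_natAbs ⟨J c', h⟩ ?_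
  rw [Int.natAbs_natCast]
  exact Nat.lt_succ_self _

/-- **No `ℤ`-valued move-invariant** (bundled form). [folklore] -/
theorem invariant_int_eq_zero (J : FormalRep →+ ℤ) (hJ : relations ≤ J.ker) : J = 0 :=
  AddMonoidHom.ext fun c => invariant_int_apply_eq_zero J hJ c

/-- **No finite-valued move-invariant** (parities, residues, …). [folklore] -/
theorem invariant_finite_apply_eq_zero {A : Type*} [AddCommGroup A] [Finite A] (J : FormalRep →+ A)
    (hJ : relations ≤ J.ker) (c : FormalRep) : J c = 0 := by
  obtain ⟨c', h⟩ := invariant_divisible J hJ c (Nat.card_pos (α := A)).ne'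
  rw [h]
  exact addOrderOf_dvd_iff_nsmul_eq_zero.mp (addOrderOf_dvd_natCard (J c'))

/-- Composition with any additive map preserves move-invariance. [folklore] -/
theorem invariant_comp_le {A B : Type*} [AddCommGroup A] [AddCommGroup B] (g : A →+ B)
    (J : FormalRep →+ A) (hJ : relations ≤ J.ker) : relations ≤ (g.comp J).ker := fun x hx => by
  rw [AddMonoidHom.mem_ker, AddMonoidHom.comp_apply, (AddMonoidHom.mem_ker).mp (hJ hx), map_zero]

/-- **No move-invariant with finitely generated values**: by the structure theorem
`A ≃ ℤⁿ × ⨁ ℤ/pᵢ^{eᵢ}`, the free coordinates are `ℤ`-valued invariants and the torsion coordinates are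
finite-valued ones. So a separating invariant, if any, takes values in a group that is not finitely
generated (e.g. `ℝ`, `ℝ ⊗ ℝ/2πℚ`, a `ℚ`-vector space). [folklore] -/
theorem invariant_fg_apply_eq_zero {A : Type*} [AddCommGroup A] [AddGroup.FG A] (J : FormalRep →+ A)
    (hJ : relations ≤ J.ker) (c : FormalRep) : J c = 0 := by
  obtain ⟨n, ι, _, p, hp, e, ⟨f⟩⟩ := AddCommGroup.equiv_free_prod_directSum_zmod A
  have hJ' : relations ≤ (f.toAddMonoidHom.comp J).ker := invariant_comp_le f.toAddMonoidHom J hJ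
  have h1 : ∀ k : Fin n, (f (J c)).1 k = 0 := fun k =>
    invariant_int_apply_eq_zero
      (((Finsupp.applyAddHom k).comp (AddMonoidHom.fst (Fin n →₀ ℤ) (DirectSum ι fun i => ZMod (p i ^ e i)))).comp
        (f.toAddMonoidHom.comp J))
      (invariant_comp_le _ (f.toAddMonoidHom.comp J) hJ') c
  have h2 : ∀ i : ι, DirectSum.component ℤ ι (fun i => ZMod (p i ^ e i)) i (f (J c)).2 = 0 := fun i => by
    haveI : NeZero (p i ^ e i) := ⟨pow_ne_zero _ (hp i).ne_zero⟩
    exact invariant_finite_apply_eq_zero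
      (((DirectSum.component ℤ ι (fun i => ZMod (p i ^ e i)) i).toAddMonoidHom.comp
        (AddMonoidHom.snd (Fin n →₀ ℤ) (DirectSum ι fun i => ZMod (p i ^ e i)))).comp
        (f.toAddMonoidHom.comp J))
      (invariant_comp_le _ (f.toAddMonoidHom.comp J) hJ') c
  have key : f (J c) = 0 :=
    Prod.ext (Finsupp.ext h1) (DirectSum.ext_component ℤ fun i => (h2 i).trans (map_zero _).symm)
  exact f.injective (key.trans (map_zero f).symm)

/-- So a `ℤ`-valued invariant never separates: the refutation template of `Negative/Core.lean`
(`not_summit_of_separating_invariant`) has no instance with `A = ℤ`. [folklore] -/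
theorem not_separating_of_int (J : FormalRep →+ ℤ)
    (hJ : ∀ x ∈ domainAddRel ∪ integrandAddRel ∪ changeOfVariablesRel ∪ newtonLeibnizRel, J x = 0)
    (c : FormalRep) : ¬ J c ≠ 0 :=
  not_not.mpr (invariant_int_apply_eq_zero J ((relations_le_ker_iff J).mpr hJ) c)

/-- … nor a finite-valued one. [folklore] -/
theorem not_separating_of_finite {A : Type*} [AddCommGroup A] [Finite A] (J : FormalRep →+ A)
    (hJ : ∀ x ∈ domainAddRel ∪ integrandAddRel ∪ changeOfVariablesRel ∪ newtonLeibnizRel, J x = 0)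
    (c : FormalRep) : ¬ J c ≠ 0 :=
  not_not.mpr (invariant_finite_apply_eq_zero J ((relations_le_ker_iff J).mpr hJ) c)

/-- **"Only a multiple is derivable" is no failure mode**: `m • c ∈ relations ↔ c ∈ relations` for
`m ≠ 0` (tree theorem `mem_relations_of_nsmul_mem_relations`), although division by integers is not a
rule of the calculus. [folklore] -/
theorem nsmul_mem_relations_iff {m : ℕ} (hm : m ≠ 0) (c : FormalRep) :
    m • c ∈ relations ↔ c ∈ relations :=
  ⟨mem_relations_of_nsmul_mem_relations hm, fun h => relations.nsmul_mem h m⟩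

end Summit.KontsevichZagierPeriods.SectorComplement.Negative
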